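import Summits.QuantumFields.YangMills.Theorems.ChatterjeeMassGapTorusAxialBoxBitCompact
import HarnessLib

/-!
# Crux `NT` (stmt-QuantumFields-19353), strong-coupling rung 3: the RING TRANSFER for temporal tubes of plaquettes

Helper file of the fleet lead prover of crux `NT` (unit `ym-spine-19353-p1`, g26), for the stub
`stub_higherMirror_free_jet` of `Cruxes/NT/Lines/slab_response_fh_rung3.lean` (the free order-16 pair jet at height 2,
whose Haar constant is the integral of the centred plaquette function over the EIGHTEEN faces of the temporal tube
`∂([-2,2]₀ × [0,1]_a × [0,1]_b)`).

The tree evaluates the TEN-face box integral by nine explicit one-link merges (`S28BoxConvChain`, `S28BoxConvGluing`: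
`∫ ∏_{f ∈ ∂B} φ(U_f) = φ^{⋆10}(1)`).  Here the same hypothesis-free MERGE (`S28BoxConv.integral_merge_kernel₂`) is
organised so that it iterates over tubes of ANY length:

* `ring_transfer` — gluing the four temporal faces over a unit square to a disc carrying a class function `ψ` of the
  plaquette word `a b c⁻¹ d⁻¹` of the square produces a disc carrying `ψ ⋆ φ^{⋆4}` of the plaquette word of the
  translated square `a' b' c'⁻¹ d'⁻¹` (four merges along `a, b, c, d`; the co-tree temporal links cancel freely at once,
  so NO word growth); the twelve links are abstract (`ZdEdge 4`), pairwise distinctness is the only geometry used;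
* `cap_merge` — gluing the last face (the far cap, same plaquette word as the disc) closes the sphere: `∫ ψ(w) φ(w) Y = (ψ ⋆ φ)(1) ∫ Y`.

Part II (`…LongTubeIntegral`) iterates `ring_transfer` four times between the two caps and gets
`κ(T₁₈) = φ^{⋆18}(1) = ‖φ^{⋆9}‖² > 0` for every compact `G` and every continuous unitary `ρ` with non-constant `Re χ_ρ`.

HONEST FRAMING: Haar-measure algebra on an arbitrary compact group; nothing about `β`, NT or the gap. [folklore]
-/

noncomputable section

open MeasureTheory Filter Topology
open Literature.MathematicalPhysics.QuantumLattice
open Literature.MathematicalPhysics.QuantumFieldTheory (zdHaar haarProbability)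

namespace Summit.QuantumFields.YangMills.Cruxes.NT.StrongCouplingRung.LongTube

open Summit.QuantumFields.YangMills.Theorems.S28BoxConv

variable {G : Type} [Group G] [TopologicalSpace G] [IsTopologicalGroup G]
  [CompactSpace G] [MeasurableSpace G] [BorelSpace G] [SecondCountableTopology G]

/-- **Ring transfer.**  Disc `ψ(a b c⁻¹ d⁻¹)` (a class function of the plaquette word of a unit square with links
`a, b, c, d`), the four temporal faces over the square (temporal links `t₀, t₁, t₂, t₃` over the corners, far links
`a', b', c', d'`), spectator `Y` not depending on `a, b, c, d`: after the four merges along `a, b, c, d` the disc carries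
`P₄ = ψ ⋆ φ ⋆ φ ⋆ φ ⋆ φ` of the far plaquette word `a' b' c'⁻¹ d'⁻¹` (kernels `P₁ … P₄` given by the hypotheses
`hK₁ … hK₄`, in the orientations the merges meet). [folklore] -/
theorem ring_transfer {ψ φ P₁ P₂ P₃ P₄ : G → ℝ} (hψ : Continuous ψ) (hφ : Continuous φ)
    (hP₁ : Continuous P₁) (hP₂ : Continuous P₂) (hP₃ : Continuous P₃)
    (hψc : ∀ s t : G, ψ (s * t) = ψ (t * s)) (hφc : ∀ s t : G, φ (s * t) = φ (t * s))
    (hP₁c : ∀ s t : G, P₁ (s * t) = P₁ (t * s)) (hP₂c : ∀ s t : G, P₂ (s * t) = P₂ (t * s))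
    (hP₃c : ∀ s t : G, P₃ (s * t) = P₃ (t * s)) (hP₄c : ∀ s t : G, P₄ (s * t) = P₄ (t * s))
    (hinv : ∀ h : G, φ h⁻¹ = φ h)
    (hK₁ : ∀ x y : G, ∫ g, φ (x * g⁻¹) * ψ (g * y) ∂haarProbability G = P₁ (x * y))
    (hK₂ : ∀ x y : G, ∫ g, φ (x * g⁻¹) * P₁ (g * y) ∂haarProbability G = P₂ (x * y))
    (hK₃ : ∀ x y : G, ∫ g, P₂ (x * g⁻¹) * φ (g * y) ∂haarProbability G = P₃ (x * y))
    (hK₄ : ∀ x y : G, ∫ g, P₃ (x * g⁻¹) * φ (g * y) ∂haarProbability G = P₄ (x * y))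
    (a b c d t₀ t₁ t₂ t₃ a' b' c' d' : ZdEdge 4)
    (ha : a ∉ ({b, c, d, t₀, t₁, t₂, t₃, a', b', c', d'} : Finset (ZdEdge 4)))
    (hb : b ∉ ({a, c, d, t₀, t₁, t₂, t₃, a', b', c', d'} : Finset (ZdEdge 4)))
    (hc : c ∉ ({a, b, d, t₀, t₁, t₂, t₃, a', b', c', d'} : Finset (ZdEdge 4)))
    (hd : d ∉ ({a, b, c, t₀, t₁, t₂, t₃, a', b', c', d'} : Finset (ZdEdge 4)))
    {Y : LGConfig 4 G → ℝ} (hYc : Continuous Y)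
    (hYa : ∀ (U : LGConfig 4 G) (g : G), Y (Function.update U a g) = Y U)
    (hYb : ∀ (U : LGConfig 4 G) (g : G), Y (Function.update U b g) = Y U)
    (hYc' : ∀ (U : LGConfig 4 G) (g : G), Y (Function.update U c g) = Y U)
    (hYd : ∀ (U : LGConfig 4 G) (g : G), Y (Function.update U d g) = Y U) :
    ∫ U, ψ (U a * U b * (U c)⁻¹ * (U d)⁻¹) *
        (φ (U t₀ * U a' * (U t₁)⁻¹ * (U a)⁻¹) * (φ (U t₁ * U b' * (U t₃)⁻¹ * (U b)⁻¹) *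
        (φ (U t₂ * U c' * (U t₃)⁻¹ * (U c)⁻¹) * (φ (U t₀ * U d' * (U t₂)⁻¹ * (U d)⁻¹) * Y U)))) ∂zdHaar 4 G =
      ∫ U, P₄ (U a' * U b' * (U c')⁻¹ * (U d')⁻¹) * Y U ∂zdHaar 4 G := by
  simp only [Finset.mem_insert, Finset.mem_singleton, not_or] at ha hb hc hd
  obtain ⟨hab, hac, had, ha0, ha1, ha2, ha3, haa, hab', hac', had'⟩ := ha
  obtain ⟨hba, hbc, hbd, hb0, hb1, hb2, hb3, hba', hbb, hbc', hbd'⟩ := hb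
  obtain ⟨hca, hcb, hcd, hc0, hc1, hc2, hc3, hca', hcb', hcc, hcd'⟩ := hc
  obtain ⟨hda, hdb, hdc, hd0, hd1, hd2, hd3, hda', hdb', hdc', hdd⟩ := hd
  -- merge 1, along `a`: face `A` (`f₁ = φ`, `X₁ = t₀ a' t₁⁻¹`, `X₂ = 1`) and the disc (`f₂ = ψ`, `W₁ = 1`, `W₂ = b c⁻¹ d⁻¹`)
  have M1 : ∫ U, ψ (U a * U b * (U c)⁻¹ * (U d)⁻¹) *
        (φ (U t₀ * U a' * (U t₁)⁻¹ * (U a)⁻¹) * (φ (U t₁ * U b' * (U t₃)⁻¹ * (U b)⁻¹) *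
        (φ (U t₂ * U c' * (U t₃)⁻¹ * (U c)⁻¹) * (φ (U t₀ * U d' * (U t₂)⁻¹ * (U d)⁻¹) * Y U)))) ∂zdHaar 4 G =
      ∫ U, P₁ (U t₀ * U a' * (U t₁)⁻¹ * U b * (U c)⁻¹ * (U d)⁻¹) *
        (φ (U t₁ * U b' * (U t₃)⁻¹ * (U b)⁻¹) *
        φ (U t₂ * U c' * (U t₃)⁻¹ * (U c)⁻¹) * φ (U t₀ * U d' * (U t₂)⁻¹ * (U d)⁻¹) * Y U) ∂zdHaar 4 G := by
    refine integral_merge_kernel₂ a hφ hψ hφc hψc hP₁c hK₁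
      (X₁ := fun U => U t₀ * U a' * (U t₁)⁻¹) (X₂ := fun _ => 1) (W₁ := fun _ => 1)
      (W₂ := fun U => U b * (U c)⁻¹ * (U d)⁻¹)
      (Y := fun U => φ (U t₁ * U b' * (U t₃)⁻¹ * (U b)⁻¹) *
        φ (U t₂ * U c' * (U t₃)⁻¹ * (U c)⁻¹) * φ (U t₀ * U d' * (U t₂)⁻¹ * (U d)⁻¹) * Y U)
      (by fun_prop) (by fun_prop) (by fun_prop) (by fun_prop)
      (fun U g => by simp only [Function.update_of_ne (Ne.symm ha0), Function.update_of_ne (Ne.symm haa),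
        Function.update_of_ne (Ne.symm ha1)])
      (fun _ _ => rfl) (fun _ _ => rfl)
      (fun U g => by simp only [Function.update_of_ne (Ne.symm hab), Function.update_of_ne (Ne.symm hac),
        Function.update_of_ne (Ne.symm had)])
      (by fun_prop)
      (fun U g => by
        simp only [Function.update_of_ne (Ne.symm ha1), Function.update_of_ne (Ne.symm hab'), Function.update_of_ne (Ne.symm ha3),
          Function.update_of_ne (Ne.symm hab), Function.update_of_ne (Ne.symm ha2), Function.update_of_ne (Ne.symm hac'),
          Function.update_of_ne (Ne.symm hac), Function.update_of_ne (Ne.symm ha0), Function.update_of_ne (Ne.symm had'),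
          Function.update_of_ne (Ne.symm had), hYa])
      (fun U => ?_) (fun U => ?_)
    · simp only [one_mul, mul_one, mul_assoc]; ring
    · simp only [mul_one, mul_assoc]
  -- merge 2, along `b`: face `B` (`f₁ = φ`, `X₁ = t₁ b' t₃⁻¹`, `X₂ = 1`) and the disc (`f₂ = P₁`, `W₁ = t₀ a' t₁⁻¹`, `W₂ = c⁻¹ d⁻¹`)
  have M2 : ∫ U, P₁ (U t₀ * U a' * (U t₁)⁻¹ * U b * (U c)⁻¹ * (U d)⁻¹) *
        (φ (U t₁ * U b' * (U t₃)⁻¹ * (U b)⁻¹) *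
        φ (U t₂ * U c' * (U t₃)⁻¹ * (U c)⁻¹) * φ (U t₀ * U d' * (U t₂)⁻¹ * (U d)⁻¹) * Y U) ∂zdHaar 4 G =
      ∫ U, P₂ (U b' * (U t₃)⁻¹ * (U c)⁻¹ * (U d)⁻¹ * U t₀ * U a') *
        (φ (U t₂ * U c' * (U t₃)⁻¹ * (U c)⁻¹) * φ (U t₀ * U d' * (U t₂)⁻¹ * (U d)⁻¹) * Y U) ∂zdHaar 4 G := by
    refine integral_merge_kernel₂ b hφ hP₁ hφc hP₁c hP₂c hK₂
      (X₁ := fun U => U t₁ * U b' * (U t₃)⁻¹) (X₂ := fun _ => 1) (W₁ := fun U => U t₀ * U a' * (U t₁)⁻¹)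
      (W₂ := fun U => (U c)⁻¹ * (U d)⁻¹)
      (Y := fun U => φ (U t₂ * U c' * (U t₃)⁻¹ * (U c)⁻¹) * φ (U t₀ * U d' * (U t₂)⁻¹ * (U d)⁻¹) * Y U)
      (by fun_prop) (by fun_prop) (by fun_prop) (by fun_prop)
      (fun U g => by simp only [Function.update_of_ne (Ne.symm hb1), Function.update_of_ne (Ne.symm hbb),
        Function.update_of_ne (Ne.symm hb3)])
      (fun _ _ => rfl)
      (fun U g => by simp only [Function.update_of_ne (Ne.symm hb0), Function.update_of_ne (Ne.symm hba'),
        Function.update_of_ne (Ne.symm hb1)])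
      (fun U g => by simp only [Function.update_of_ne (Ne.symm hbc), Function.update_of_ne (Ne.symm hbd)])
      (by fun_prop)
      (fun U g => by
        simp only [Function.update_of_ne (Ne.symm hb2), Function.update_of_ne (Ne.symm hbc'), Function.update_of_ne (Ne.symm hb3),
          Function.update_of_ne (Ne.symm hbc), Function.update_of_ne (Ne.symm hb0), Function.update_of_ne (Ne.symm hbd'),
          Function.update_of_ne (Ne.symm hbd), hYb])
      (fun U => ?_) (fun U => ?_)
    · simp only [mul_one, mul_assoc]; ring
    · simp only [mul_one, mul_assoc]
      rw [hP₂c (U t₁)]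
      simp only [mul_assoc, inv_mul_cancel, mul_one]
  -- merge 3, along `c`: the disc (`f₁ = P₂`, `X₁ = b' t₃⁻¹`, `X₂ = d⁻¹ t₀ a'`) and face `C` read backwards
  -- (`φ(t₂ c' t₃⁻¹ c⁻¹) = φ(c t₃ c'⁻¹ t₂⁻¹)`, `f₂ = φ`, `W₁ = 1`, `W₂ = t₃ c'⁻¹ t₂⁻¹`)
  have M3 : ∫ U, P₂ (U b' * (U t₃)⁻¹ * (U c)⁻¹ * (U d)⁻¹ * U t₀ * U a') *
        (φ (U t₂ * U c' * (U t₃)⁻¹ * (U c)⁻¹) * φ (U t₀ * U d' * (U t₂)⁻¹ * (U d)⁻¹) * Y U) ∂zdHaar 4 G =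
      ∫ U, P₃ (U b' * (U c')⁻¹ * (U t₂)⁻¹ * (U d)⁻¹ * U t₀ * U a') *
        (φ (U t₀ * U d' * (U t₂)⁻¹ * (U d)⁻¹) * Y U) ∂zdHaar 4 G := by
    refine integral_merge_kernel₂ c hP₂ hφ hP₂c hφc hP₃c hK₃
      (X₁ := fun U => U b' * (U t₃)⁻¹) (X₂ := fun U => (U d)⁻¹ * U t₀ * U a') (W₁ := fun _ => 1)
      (W₂ := fun U => U t₃ * (U c')⁻¹ * (U t₂)⁻¹)
      (Y := fun U => φ (U t₀ * U d' * (U t₂)⁻¹ * (U d)⁻¹) * Y U)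
      (by fun_prop) (by fun_prop) (by fun_prop) (by fun_prop)
      (fun U g => by simp only [Function.update_of_ne (Ne.symm hcb'), Function.update_of_ne (Ne.symm hc3)])
      (fun U g => by simp only [Function.update_of_ne (Ne.symm hcd), Function.update_of_ne (Ne.symm hc0),
        Function.update_of_ne (Ne.symm hca')])
      (fun _ _ => rfl)
      (fun U g => by simp only [Function.update_of_ne (Ne.symm hc3), Function.update_of_ne (Ne.symm hcc),
        Function.update_of_ne (Ne.symm hc2)])
      (by fun_prop)
      (fun U g => by
        simp only [Function.update_of_ne (Ne.symm hc0), Function.update_of_ne (Ne.symm hcd'), Function.update_of_ne (Ne.symm hc2),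
          Function.update_of_ne (Ne.symm hcd), hYc'])
      (fun U => ?_) (fun U => ?_)
    · have e : φ (U t₂ * U c' * (U t₃)⁻¹ * (U c)⁻¹) = φ (1 * U c * (U t₃ * (U c')⁻¹ * (U t₂)⁻¹)) := by
        rw [← hinv (1 * U c * (U t₃ * (U c')⁻¹ * (U t₂)⁻¹))]
        simp only [one_mul, mul_inv_rev, inv_inv, mul_assoc]
      rw [e]; simp only [mul_assoc]
    · simp only [one_mul, mul_assoc, inv_mul_cancel_left]
  -- merge 4, along `d`: the disc (`f₁ = P₃`, `X₁ = b' c'⁻¹ t₂⁻¹`, `X₂ = t₀ a'`) and face `D` read backwards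
  -- (`φ(t₀ d' t₂⁻¹ d⁻¹) = φ(d t₂ d'⁻¹ t₀⁻¹)`, `f₂ = φ`, `W₁ = 1`, `W₂ = t₂ d'⁻¹ t₀⁻¹`)
  have M4 : ∫ U, P₃ (U b' * (U c')⁻¹ * (U t₂)⁻¹ * (U d)⁻¹ * U t₀ * U a') *
        (φ (U t₀ * U d' * (U t₂)⁻¹ * (U d)⁻¹) * Y U) ∂zdHaar 4 G =
      ∫ U, P₄ (U a' * U b' * (U c')⁻¹ * (U d')⁻¹) * Y U ∂zdHaar 4 G := by
    refine integral_merge_kernel₂ d hP₃ hφ hP₃c hφc hP₄c hK₄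
      (X₁ := fun U => U b' * (U c')⁻¹ * (U t₂)⁻¹) (X₂ := fun U => U t₀ * U a') (W₁ := fun _ => 1)
      (W₂ := fun U => U t₂ * (U d')⁻¹ * (U t₀)⁻¹) (Y := Y)
      (by fun_prop) (by fun_prop) (by fun_prop) (by fun_prop)
      (fun U g => by simp only [Function.update_of_ne (Ne.symm hdb'), Function.update_of_ne (Ne.symm hdc'),
        Function.update_of_ne (Ne.symm hd2)])
      (fun U g => by simp only [Function.update_of_ne (Ne.symm hd0), Function.update_of_ne (Ne.symm hda')])
      (fun _ _ => rfl)
      (fun U g => by simp only [Function.update_of_ne (Ne.symm hd2), Function.update_of_ne (Ne.symm hdd),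
        Function.update_of_ne (Ne.symm hd0)])
      hYc hYd
      (fun U => ?_) (fun U => ?_)
    · have e : φ (U t₀ * U d' * (U t₂)⁻¹ * (U d)⁻¹) = φ (1 * U d * (U t₂ * (U d')⁻¹ * (U t₀)⁻¹)) := by
        rw [← hinv (1 * U d * (U t₂ * (U d')⁻¹ * (U t₀)⁻¹))]
        simp only [one_mul, mul_inv_rev, inv_inv, mul_assoc]
      rw [e]; simp only [mul_assoc]
    · simp only [one_mul, mul_assoc, inv_mul_cancel_left]
      rw [hP₄c (U b')]
      simp only [mul_assoc]
      rw [hP₄c ((U c')⁻¹)]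
      simp only [mul_assoc]
      rw [hP₄c ((U d')⁻¹)]
      simp only [mul_assoc]
  rw [M1, M2, M3, M4]

/-- **Cap merge.**  Closing the sphere: the disc `ψ` and the last face `φ` carry the SAME plaquette word
`w = a b c⁻¹ d⁻¹`; reading the face backwards and merging along `a` leaves the kernel at the identity:
`∫ ψ(w) φ(w) = P(1)` for `∫ φ(x g⁻¹) ψ(g y) dg = P(x y)`. [folklore] -/
theorem cap_merge {ψ φ P : G → ℝ} (hψ : Continuous ψ) (hφ : Continuous φ)
    (hψc : ∀ s t : G, ψ (s * t) = ψ (t * s)) (hφc : ∀ s t : G, φ (s * t) = φ (t * s))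
    (hPc : ∀ s t : G, P (s * t) = P (t * s)) (hinv : ∀ h : G, φ h⁻¹ = φ h)
    (hK : ∀ x y : G, ∫ g, φ (x * g⁻¹) * ψ (g * y) ∂haarProbability G = P (x * y))
    (a b c d : ZdEdge 4) (ha : a ∉ ({b, c, d} : Finset (ZdEdge 4))) :
    ∫ U, ψ (U a * U b * (U c)⁻¹ * (U d)⁻¹) * φ (U a * U b * (U c)⁻¹ * (U d)⁻¹) ∂zdHaar 4 G = P 1 := by
  simp only [Finset.mem_insert, Finset.mem_singleton, not_or] at ha
  obtain ⟨hab, hac, had⟩ := ha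
  have h : ∫ U, ψ (U a * U b * (U c)⁻¹ * (U d)⁻¹) * φ (U a * U b * (U c)⁻¹ * (U d)⁻¹) ∂zdHaar 4 G =
      ∫ U, (fun _ => P 1) U ∂zdHaar 4 G := by
    refine integral_merge_kernel₂ a hφ hψ hφc hψc hPc hK
      (X₁ := fun U => U d * U c * (U b)⁻¹) (X₂ := fun _ => 1) (W₁ := fun _ => 1)
      (W₂ := fun U => U b * (U c)⁻¹ * (U d)⁻¹) (Y := fun _ => 1)
      (by fun_prop) (by fun_prop) (by fun_prop) (by fun_prop)
      (fun U g => by simp only [Function.update_of_ne (Ne.symm had), Function.update_of_ne (Ne.symm hac),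
        Function.update_of_ne (Ne.symm hab)])
      (fun _ _ => rfl) (fun _ _ => rfl)
      (fun U g => by simp only [Function.update_of_ne (Ne.symm hab), Function.update_of_ne (Ne.symm hac),
        Function.update_of_ne (Ne.symm had)])
      (by fun_prop) (fun _ _ => rfl) (fun U => ?_) (fun U => ?_)
    · have e : φ (U a * U b * (U c)⁻¹ * (U d)⁻¹) = φ (U d * U c * (U b)⁻¹ * (U a)⁻¹ * 1) := by
        rw [← hinv (U d * U c * (U b)⁻¹ * (U a)⁻¹ * 1)]
        simp only [mul_one, mul_inv_rev, inv_inv, mul_assoc]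
      rw [e]; simp only [one_mul, mul_one, mul_assoc]; ring
    · simp only [mul_one, mul_assoc, inv_mul_cancel_left, mul_inv_cancel_left, mul_inv_cancel]
  rw [h]
  simp only [integral_const, probReal_univ, one_smul]

end Summit.QuantumFields.YangMills.Cruxes.NT.StrongCouplingRung.LongTube

end
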